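import Summits.QuantumFields.YangMills.Theorems.SlowBitWindowPersistenceChain
import Summits.QuantumFields.YangMills.Theorems.SwapTwistTraceDefs
import HarnessLib

/-!
# The swap-twisted zero-flux ring off the Polyakov strip: far bonds, and the STRIP DOOR
# `Z^S_phys(2L) ≤ Z^S_strip + e^{β(2|E| − t²/2)}·(e^{2β|E|})^{2L−1}`

Support module for `SwapTwistDeficit.TwistRatioVanishesFixedL` (item stmt-QuantumFields-23802, O1 of LINE g11-A of seat ym-idea-4) and the
twist-ratio window (companions `…TwistedRingInsertion`, `…TwistRatioWindow`).  The swap-twisted trace `Z^S = TT.twistTrace L β (2L)` is the closed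
chain of `2L−1` bonds `K_β(U_i, U_{i+1})` and the seam `K_β^P(U_{2L−1}, S U_0)`, `S` the exchange of the spatial axes `0, 1`.  Along the chain the
distance-to-centre `p = polDist` of the `x`-Polyakov holonomy moves by at most `L·t` per bond unless a link of that bond moves by more than `t`
(`|p(U) − p(V)| ≤ Σ_j ‖U_{ℓ_j} − V_{ℓ_j}‖_F`), and the seam is no exception once the gauge∕twist average is opened (`p` is gauge and centre-twist
invariant).  Hence OFF the strip `{|p(U_0) − p(S U_0)| ≤ 2L·(L t)}` some bond of the ring is `t`-far and costs `e^{−βt²/2}` against its supremum: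

* §1 `polDist_gaugeTransform_twist3`, ★ `physAvg_transferKernel_le_of_polDist_far` — the SEAM LEMMA: if `|p(U) − p(V)| > L·t` then
  `K_β^P(U, V) = (1/8)Σ_z ∫ K_β(U, g·tw_z V) dg ≤ e^{β(2|E| − t²/2)}` (every configuration in the physical orbit of `V` has the same `p`);
* §2 `abs_polDist_chain_le` — telescoping along `t`-close bonds: `|p(U_0) − p(U_k)| ≤ k·L·t`;
* §3 `twistChain_mul_indicator_compl_strip_le` — POINTWISE: off the strip the twisted chain is `≤ e^{β(2|E|−t²/2)}·(e^{2β|E|})^{n}` (case split: a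
  `t`-far plain bond, or all plain bonds close and then the seam is far in `p`);
* §4 ★ `twistTrace_le_twistChainStrip_add` — integrating: `Z^S(2L) ≤ ∫ 𝟙_strip(U_0)·(twisted chain) + e^{β(2|E|−t²/2)}(e^{2β|E|})^{2L−1}`, and
  `twistTrace_two_mul_nonneg`.
With `…TwistedRingInsertion.twistChainIndicator_le_insTrace` (`Z^S_strip ≤ Z_strip`) this is the door `Z^S ≤ insTrace L β 𝟙_strip 0 + far cost`.

HONEST FRAMING: fixed-lattice bookkeeping for a support item of a DRAFT line onto a RECORD rung (K2a); no semiclassics; nothing about infinite volume,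
the continuum limit or the Clay gap; the YM mass gap is NOT proved.  No `sorry`, no new axiom, no new definition.
References: [cite: tHooft1979Flux]; [cite: SeilerLNP1982, §3] (transfer kernels, far-link suppression); [cite: Luscher1983, §2] (Polyakov holonomies,
zero-flux projection); [cite: MontvayMunster1994, (3.145)].
-/

set_option autoImplicit false

noncomputable section

open MeasureTheory Filter Topology Real Function
open scoped Matrix ComplexConjugate BigOperators
open Literature.MathematicalPhysics.QuantumLattice
open Literature.MathematicalPhysics.QuantumFieldTheory hiding SU2
open Summit.QuantumFields.YangMills.Theorems

namespace Summit.QuantumFields.YangMills.Theorems.FemtoTransferGap.TT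

open Summit.QuantumFields.YangMills.Theorems.FemtoTransferGap
open Summit.QuantumFields.YangMills.Theorems.FemtoTransferGap.PhysL2
open Summit.QuantumFields.YangMills.Theorems.FemtoTransferGap.FlatSheet

variable {L : ℕ} [NeZero L]

/-! ## §1 The seam lemma: the physically averaged bond is small between `polDist`-far configurations -/

/-- `polDist` is constant on physical orbits: `p(g · tw_z V) = p(V)` (gauge invariance and invariance under the three centre twists).
[cite: Luscher1983, §2] [cite: tHooft1979Flux] -/
theorem polDist_gaugeTransform_twist3 (g : Site 3 L → SU2) (z : Fin 3 → Bool) (V : GaugeConfig 3 L SU2) :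
    polDist (gaugeTransform g (twist3 z V)) = polDist V := by
  rw [polDist_gaugeTransform]
  unfold twist3
  rw [polDist_twist 0 (centreElem_mem_center _), polDist_twist 1 (centreElem_mem_center _), polDist_twist 2 (centreElem_mem_center _)]

/-- `K_β^P(U, V) ≤ (e^{2β})^{|E|}` (`β ≥ 0`). [folklore] -/
theorem physAvg_transferKernel_le_pow {β : ℝ} (hβ : 0 ≤ β) (U V : GaugeConfig 3 L SU2) :
    physAvg (transferKernel su2Rep β U) V ≤ Real.exp (2 * β) ^ Fintype.card (Edge 3 L) :=
  (le_abs_self _).trans (abs_physAvg_le (fun W => abs_transferKernel_le_lat hβ (U, W)) V)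

/-- ★ **SEAM LEMMA.**  If `|polDist U − polDist V| > L·t` (`β, t ≥ 0`) then the physically averaged bond is exponentially small:
`K_β^P(U, V) = (1/8) Σ_z ∫ K_β(U, g·tw_z V) dg ≤ e^{β(2|E| − t²/2)}` — every `W = g·tw_z V` has `polDist W = polDist V`, so some axis link of
`(U, W)` is `t`-far and `K_β(U, W) ≤ e^{β(2|E| − t²/2)}`. [cite: SeilerLNP1982, §3] [cite: Luscher1983, §2] -/
theorem physAvg_transferKernel_le_of_polDist_far {β : ℝ} (hβ : 0 ≤ β) {t : ℝ} (ht : 0 ≤ t) {U V : GaugeConfig 3 L SU2}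
    (h : (L : ℝ) * t < |polDist U - polDist V|) :
    physAvg (transferKernel su2Rep β U) V ≤ Real.exp (β * (2 * (Fintype.card (Edge 3 L) : ℝ) - t ^ 2 / 2)) := by
  haveI := isProbabilityMeasure_gaugeMeasure (L := L)
  set η : ℝ := Real.exp (β * (2 * (Fintype.card (Edge 3 L) : ℝ) - t ^ 2 / 2)) with hη
  have hW : ∀ (g : Site 3 L → SU2) (z : Fin 3 → Bool), transferKernel su2Rep β U (gaugeTransform g (twist3 z V)) ≤ η := by
    intro g z
    have h' : (L : ℝ) * t < |polDist U - polDist (gaugeTransform g (twist3 z V))| := by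
      rwa [polDist_gaugeTransform_twist3]
    obtain ⟨j, -, hfar⟩ := exists_far_lineEdge U _ h'
    exact transferKernel_le_of_far_link hβ (lineEdge L j) ht hfar.le
  have h1 : ∀ z : Fin 3 → Bool, ∫ g, transferKernel su2Rep β U (gaugeTransform g (twist3 z V)) ∂gaugeMeasure L ≤ η := by
    intro z
    have hm := integral_mono_of_nonneg (μ := gaugeMeasure L) (f := fun g => transferKernel su2Rep β U (gaugeTransform g (twist3 z V)))
      (g := fun _ => η) (ae_of_all _ fun g => (transferKernel_pos _ _ _ _).le) (integrable_const η) (ae_of_all _ fun g => hW g z)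
    simpa only [integral_const, smul_eq_mul, probReal_univ, one_mul] using hm
  unfold physAvg
  calc (1 / 8 : ℝ) * ∑ z : Fin 3 → Bool, ∫ g, transferKernel su2Rep β U (gaugeTransform g (twist3 z V)) ∂gaugeMeasure L
      ≤ (1 / 8 : ℝ) * ∑ _z : Fin 3 → Bool, η := mul_le_mul_of_nonneg_left (Finset.sum_le_sum fun z _ => h1 z) (by norm_num)
    _ = η := by simp

/-! ## §2 Telescoping `polDist` along `t`-close bonds -/

omit [NeZero L] in
/-- Along a chain whose first `n` bonds have all links `t`-close, `|polDist(U_0) − polDist(U_k)| ≤ k · (L t)` for `k ≤ n`.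
[cite: Luscher1983, §2] -/
theorem abs_polDist_chain_le {n : ℕ} (Us : Fin (n + 1) → GaugeConfig 3 L SU2) {t : ℝ}
    (hclose : ∀ (i : Fin n) (e : Edge 3 L),
      frobNorm ((Us i.castSucc e : Matrix (Fin 2) (Fin 2) ℂ) - (Us i.succ e : Matrix (Fin 2) (Fin 2) ℂ)) ≤ t) :
    ∀ k : ℕ, (hk : k ≤ n) → |polDist (Us 0) - polDist (Us ⟨k, by omega⟩)| ≤ k * ((L : ℝ) * t) := by
  intro k
  induction k with
  | zero => intro hk; simp
  | succ k ih =>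
    intro hk
    have hk' : k < n := by omega
    have hstep : |polDist (Us ⟨k, by omega⟩) - polDist (Us ⟨k + 1, by omega⟩)| ≤ (L : ℝ) * t := by
      have hc := hclose ⟨k, hk'⟩
      exact abs_polDist_sub_le_of_forall _ _ fun j _ => hc (lineEdge L j)
    have hprev := ih (by omega)
    calc |polDist (Us 0) - polDist (Us ⟨k + 1, by omega⟩)|
        ≤ |polDist (Us 0) - polDist (Us ⟨k, by omega⟩)| + |polDist (Us ⟨k, by omega⟩) - polDist (Us ⟨k + 1, by omega⟩)| :=
          abs_sub_le _ _ _
      _ ≤ k * ((L : ℝ) * t) + (L : ℝ) * t := add_le_add hprev hstep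
      _ = ((k + 1 : ℕ) : ℝ) * ((L : ℝ) * t) := by push_cast; ring

/-! ## §3 Pointwise: off the strip the twisted chain is exponentially small -/

/-- The swap-twisted closed chain `(∏_{i<n} K_β(U_i,U_{i+1})) · K_β^P(U_n, S U_0)` is measurable on the slice space. [folklore] -/
theorem measurable_twistChain (β : ℝ) (n : ℕ) :
    Measurable fun Us : Fin (n + 1) → GaugeConfig 3 L SU2 =>
      (∏ i : Fin n, transferKernel su2Rep β (Us i.castSucc) (Us i.succ)) *
        physAvg (transferKernel su2Rep β (Us (Fin.last n))) (configPerm (Equiv.swap (0 : Fin 3) 1) (Us 0)) := by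
  have hp : Measurable fun Us : Fin (n + 1) → GaugeConfig 3 L SU2 => ∏ i : Fin n, transferKernel su2Rep β (Us i.castSucc) (Us i.succ) :=
    Finset.measurable_prod _ fun i _ => measurable_transferKernel_slices β n i.castSucc i.succ
  have h1 : Measurable fun Us : Fin (n + 1) → GaugeConfig 3 L SU2 => (Us (Fin.last n), configPerm (Equiv.swap (0 : Fin 3) 1) (Us 0)) :=
    (measurable_pi_apply _).prodMk ((configPerm (G := SU2) (L := L) (Equiv.swap (0 : Fin 3) 1)).measurable.comp (measurable_pi_apply 0))
  have h2 := (stronglyMeasurable_physKernel (L := L) β).measurable.comp h1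
  exact hp.mul (by simpa only [Function.comp_def, Function.uncurry_apply_pair, physKernel] using h2)

/-- The swap-twisted closed chain is non-negative. [folklore] -/
theorem twistChain_nonneg (β : ℝ) (n : ℕ) (Us : Fin (n + 1) → GaugeConfig 3 L SU2) :
    0 ≤ (∏ i : Fin n, transferKernel su2Rep β (Us i.castSucc) (Us i.succ)) *
        physAvg (transferKernel su2Rep β (Us (Fin.last n))) (configPerm (Equiv.swap (0 : Fin 3) 1) (Us 0)) :=
  mul_nonneg (Finset.prod_nonneg fun _ _ => (transferKernel_pos _ _ _ _).le) (physAvg_nonneg (fun V => (transferKernel_pos _ _ _ V).le) _)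

/-- The swap-twisted closed chain is bounded by `(e^{2β|E|})^{n} · e^{2β|E|}` (`β ≥ 0`). [folklore] -/
theorem twistChain_le {β : ℝ} (hβ : 0 ≤ β) (n : ℕ) (Us : Fin (n + 1) → GaugeConfig 3 L SU2) :
    (∏ i : Fin n, transferKernel su2Rep β (Us i.castSucc) (Us i.succ)) *
        physAvg (transferKernel su2Rep β (Us (Fin.last n))) (configPerm (Equiv.swap (0 : Fin 3) 1) (Us 0)) ≤
      (Real.exp (2 * β) ^ Fintype.card (Edge 3 L)) ^ n * Real.exp (2 * β) ^ Fintype.card (Edge 3 L) := by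
  set M : ℝ := Real.exp (2 * β) ^ Fintype.card (Edge 3 L) with hM
  have hKM : ∀ U V : GaugeConfig 3 L SU2, transferKernel su2Rep β U V ≤ M := fun U V =>
    (le_abs_self _).trans (abs_transferKernel_le_lat hβ (U, V))
  refine mul_le_mul ?_ (physAvg_transferKernel_le_pow hβ _ _) (physAvg_nonneg (fun V => (transferKernel_pos _ _ _ V).le) _) (by positivity)
  calc ∏ i : Fin n, transferKernel su2Rep β (Us i.castSucc) (Us i.succ) ≤ ∏ _i : Fin n, M :=
        Finset.prod_le_prod (fun i _ => (transferKernel_pos _ _ _ _).le) fun i _ => hKM _ _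
    _ = M ^ n := by rw [Finset.prod_const, Finset.card_univ, Fintype.card_fin]

set_option maxHeartbeats 800000 in
/-- **Off the strip the twisted chain is exponentially small (pointwise).**  Let `β, t ≥ 0` and `A = {|p(U) − p(SU)| ≤ (n+1)·(L t)}` (`p = polDist`).
Then `(∏_{i<n} K_β(U_i,U_{i+1})) K_β^P(U_n, SU_0) · 𝟙_{Aᶜ}(U_0) ≤ e^{β(2|E| − t²/2)} · (e^{2β|E|})^{n}`: either some plain bond has a `t`-far link
(that bond `≤ e^{β(2|E|−t²/2)}`, the others and the seam `≤ e^{2β|E|}`), or all are `t`-close, `|p(U_0) − p(U_n)| ≤ n·L·t`, hence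
`|p(U_n) − p(SU_0)| > L·t` and the seam is small (§1). [cite: SeilerLNP1982, §3] [cite: Luscher1983, §2] -/
theorem twistChain_mul_indicator_compl_strip_le {β : ℝ} (hβ : 0 ≤ β) {t : ℝ} (ht : 0 ≤ t) (n : ℕ)
    (Us : Fin (n + 1) → GaugeConfig 3 L SU2) :
    (∏ i : Fin n, transferKernel su2Rep β (Us i.castSucc) (Us i.succ)) *
        physAvg (transferKernel su2Rep β (Us (Fin.last n))) (configPerm (Equiv.swap (0 : Fin 3) 1) (Us 0)) *
        Set.indicator {U : GaugeConfig 3 L SU2 |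
          |polDist U - polDist (configPerm (Equiv.swap (0 : Fin 3) 1) U)| ≤ ((n : ℝ) + 1) * ((L : ℝ) * t)}ᶜ (fun _ => (1 : ℝ)) (Us 0) ≤
      Real.exp (β * (2 * (Fintype.card (Edge 3 L) : ℝ) - t ^ 2 / 2)) * (Real.exp (2 * β) ^ Fintype.card (Edge 3 L)) ^ n := by
  set S := configPerm (G := SU2) (L := L) (Equiv.swap (0 : Fin 3) 1) with hS
  set E : ℕ := Fintype.card (Edge 3 L) with hE
  set M : ℝ := Real.exp (2 * β) ^ E with hM
  set η : ℝ := Real.exp (β * (2 * (E : ℝ) - t ^ 2 / 2)) with hη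
  set A : Set (GaugeConfig 3 L SU2) := {U | |polDist U - polDist (S U)| ≤ ((n : ℝ) + 1) * ((L : ℝ) * t)} with hA
  have hM0 : 0 ≤ M := by positivity
  have hη0 : 0 ≤ η := (Real.exp_pos _).le
  have hKM : ∀ U V : GaugeConfig 3 L SU2, transferKernel su2Rep β U V ≤ M := fun U V =>
    (le_abs_self _).trans (abs_transferKernel_le_lat hβ (U, V))
  have hK0 : ∀ U V : GaugeConfig 3 L SU2, 0 ≤ transferKernel su2Rep β U V := fun U V => (transferKernel_pos _ _ _ _).le
  have hP0 : 0 ≤ physAvg (transferKernel su2Rep β (Us (Fin.last n))) (S (Us 0)) := physAvg_nonneg (fun V => hK0 _ V) _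
  have hPM : physAvg (transferKernel su2Rep β (Us (Fin.last n))) (S (Us 0)) ≤ M := physAvg_transferKernel_le_pow hβ _ _
  have hprod0 : 0 ≤ ∏ i : Fin n, transferKernel su2Rep β (Us i.castSucc) (Us i.succ) := Finset.prod_nonneg fun i _ => hK0 _ _
  have hprodM : ∏ i : Fin n, transferKernel su2Rep β (Us i.castSucc) (Us i.succ) ≤ M ^ n := by
    calc ∏ i : Fin n, transferKernel su2Rep β (Us i.castSucc) (Us i.succ) ≤ ∏ _i : Fin n, M :=
          Finset.prod_le_prod (fun i _ => hK0 _ _) fun i _ => hKM _ _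
      _ = M ^ n := by rw [Finset.prod_const, Finset.card_univ, Fintype.card_fin]
  by_cases hU : Us 0 ∈ A
  · have hU' : Us 0 ∉ Aᶜ := fun h => h hU
    rw [Set.indicator_of_notMem hU', mul_zero]
    positivity
  rw [Set.indicator_of_mem (Set.mem_compl hU), mul_one]
  have hfarU : ((n : ℝ) + 1) * ((L : ℝ) * t) < |polDist (Us 0) - polDist (S (Us 0))| := not_le.1 hU
  by_cases hfar : ∃ (i : Fin n) (e : Edge 3 L), t < frobNorm ((Us i.castSucc e : Matrix (Fin 2) (Fin 2) ℂ) - (Us i.succ e : Matrix (Fin 2) (Fin 2) ℂ))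
  · -- a `t`-far plain bond
    obtain ⟨i, e, he⟩ := hfar
    have hn1 : 1 ≤ n := by have := i.isLt; omega
    have hsplit : (∏ j : Fin n, transferKernel su2Rep β (Us j.castSucc) (Us j.succ)) =
        transferKernel su2Rep β (Us i.castSucc) (Us i.succ) *
          ∏ j ∈ Finset.univ.erase i, transferKernel su2Rep β (Us j.castSucc) (Us j.succ) := by
      rw [← Finset.mul_prod_erase Finset.univ _ (Finset.mem_univ i)]
    have hKi : transferKernel su2Rep β (Us i.castSucc) (Us i.succ) ≤ η := transferKernel_le_of_far_link hβ e ht he.le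
    have hrest : ∏ j ∈ Finset.univ.erase i, transferKernel su2Rep β (Us j.castSucc) (Us j.succ) ≤ M ^ (n - 1) := by
      calc ∏ j ∈ Finset.univ.erase i, transferKernel su2Rep β (Us j.castSucc) (Us j.succ) ≤ ∏ _j ∈ Finset.univ.erase i, M :=
            Finset.prod_le_prod (fun j _ => hK0 _ _) fun j _ => hKM _ _
        _ = M ^ (n - 1) := by
            rw [Finset.prod_const, Finset.card_erase_of_mem (Finset.mem_univ _), Finset.card_univ, Fintype.card_fin]
    have hrest0 : 0 ≤ ∏ j ∈ Finset.univ.erase i, transferKernel su2Rep β (Us j.castSucc) (Us j.succ) :=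
      Finset.prod_nonneg fun j _ => hK0 _ _
    have hpow : η * M ^ (n - 1) * M = η * M ^ n := by
      rw [mul_assoc, ← pow_succ, show n - 1 + 1 = n by omega]
    calc (∏ j : Fin n, transferKernel su2Rep β (Us j.castSucc) (Us j.succ)) *
          physAvg (transferKernel su2Rep β (Us (Fin.last n))) (S (Us 0))
        = transferKernel su2Rep β (Us i.castSucc) (Us i.succ) *
            (∏ j ∈ Finset.univ.erase i, transferKernel su2Rep β (Us j.castSucc) (Us j.succ)) *
            physAvg (transferKernel su2Rep β (Us (Fin.last n))) (S (Us 0)) := by rw [hsplit]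
      _ ≤ η * M ^ (n - 1) * M := mul_le_mul (mul_le_mul hKi hrest hrest0 hη0) hPM hP0 (by positivity)
      _ = η * M ^ n := hpow
  · -- all plain bonds close: the seam is far in `polDist`
    push Not at hfar
    have hchain := abs_polDist_chain_le Us hfar n le_rfl
    have hlast : (⟨n, by omega⟩ : Fin (n + 1)) = Fin.last n := rfl
    rw [hlast] at hchain
    have hseam_far : (L : ℝ) * t < |polDist (Us (Fin.last n)) - polDist (S (Us 0))| := by
      have htri : |polDist (Us 0) - polDist (S (Us 0))| ≤
          |polDist (Us 0) - polDist (Us (Fin.last n))| + |polDist (Us (Fin.last n)) - polDist (S (Us 0))| := abs_sub_le _ _ _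
      nlinarith [htri, hchain, hfarU]
    have hseam : physAvg (transferKernel su2Rep β (Us (Fin.last n))) (S (Us 0)) ≤ η :=
      physAvg_transferKernel_le_of_polDist_far hβ ht hseam_far
    calc (∏ j : Fin n, transferKernel su2Rep β (Us j.castSucc) (Us j.succ)) *
          physAvg (transferKernel su2Rep β (Us (Fin.last n))) (S (Us 0))
        ≤ M ^ n * η := mul_le_mul hprodM hseam hP0 (by positivity)
      _ = η * M ^ n := mul_comm _ _

/-! ## §4 ★ The strip door for the twisted trace -/

/-- `Z^S_phys(L, β, 2L) ≥ 0`: the swap-twisted trace is the integral of a non-negative chain. [cite: tHooft1979Flux] -/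
theorem twistTrace_two_mul_nonneg (β : ℝ) : 0 ≤ twistTrace L β (2 * L) := by
  unfold twistTrace twistTraceSucc
  exact integral_nonneg fun Us => twistChain_nonneg β _ Us

set_option maxHeartbeats 400000 in
/-- ★ **STRIP DOOR for the twisted trace.**  For `β, t ≥ 0`, with the strip `A = {|polDist − polDist∘S| ≤ 2L·(L t)}`:
`Z^S_phys(L, β, 2L) ≤ ∫ 𝟙_A(U_0) (∏_{i<2L−1} K_β(U_i,U_{i+1})) K_β^P(U_{2L−1}, S U_0) dU⃗ + e^{β(2|E| − t²/2)} · (e^{2β|E|})^{2L−1}` — the twisted ring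
splits into its part over the strip and an exponentially small far part (§3 integrated over the probability space of slices).
[cite: tHooft1979Flux] [cite: SeilerLNP1982, §3] -/
theorem twistTrace_le_twistChainStrip_add {β : ℝ} (hβ : 0 ≤ β) {t : ℝ} (ht : 0 ≤ t) :
    twistTrace L β (2 * L) ≤
      (∫ Us : Fin (2 * L - 1 + 1) → GaugeConfig 3 L SU2,
        (∏ i : Fin (2 * L - 1), transferKernel su2Rep β (Us i.castSucc) (Us i.succ)) *
          physAvg (transferKernel su2Rep β (Us (Fin.last (2 * L - 1)))) (configPerm (Equiv.swap (0 : Fin 3) 1) (Us 0)) *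
          Set.indicator {U : GaugeConfig 3 L SU2 |
            |polDist U - polDist (configPerm (Equiv.swap (0 : Fin 3) 1) U)| ≤ 2 * (L : ℝ) * ((L : ℝ) * t)} (fun _ => (1 : ℝ)) (Us 0)
        ∂(Measure.pi fun _ : Fin (2 * L - 1 + 1) => configMeasure SU2 L)) +
      Real.exp (β * (2 * (Fintype.card (Edge 3 L) : ℝ) - t ^ 2 / 2)) * (Real.exp (2 * β) ^ Fintype.card (Edge 3 L)) ^ (2 * L - 1) := by
  have hL : 1 ≤ L := NeZero.one_le
  set n : ℕ := 2 * L - 1 with hn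
  set S := configPerm (G := SU2) (L := L) (Equiv.swap (0 : Fin 3) 1) with hS
  set E : ℕ := Fintype.card (Edge 3 L) with hE
  set M : ℝ := Real.exp (2 * β) ^ E with hM
  set η : ℝ := Real.exp (β * (2 * (E : ℝ) - t ^ 2 / 2)) with hη
  set μ : Measure (Fin (n + 1) → GaugeConfig 3 L SU2) := Measure.pi fun _ => configMeasure SU2 L with hμ
  haveI : IsProbabilityMeasure μ := by rw [hμ]; infer_instance
  set F : (Fin (n + 1) → GaugeConfig 3 L SU2) → ℝ := fun Us =>
    (∏ i : Fin n, transferKernel su2Rep β (Us i.castSucc) (Us i.succ)) *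
      physAvg (transferKernel su2Rep β (Us (Fin.last n))) (S (Us 0)) with hF
  have hw : ((n : ℝ) + 1) * ((L : ℝ) * t) = 2 * (L : ℝ) * ((L : ℝ) * t) := by
    have : (n : ℝ) = 2 * (L : ℝ) - 1 := by
      rw [hn, Nat.cast_sub (by omega)]; push_cast; ring
    rw [this]; ring
  set A : Set (GaugeConfig 3 L SU2) := {U | |polDist U - polDist (S U)| ≤ 2 * (L : ℝ) * ((L : ℝ) * t)} with hA
  have hAm : MeasurableSet A := measurableSet_strip _
  have hFm : Measurable F := measurable_twistChain β n
  have hF0 : ∀ Us, 0 ≤ F Us := twistChain_nonneg β n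
  have hFb : ∀ Us, F Us ≤ M ^ n * M := twistChain_le hβ n
  have hfar : ∀ Us, F Us * Aᶜ.indicator (fun _ => (1 : ℝ)) (Us 0) ≤ η * M ^ n := by
    intro Us
    have h := twistChain_mul_indicator_compl_strip_le (L := L) hβ ht n Us
    rw [hw] at h
    exact h
  -- integrability
  have hind1 : ∀ (B : Set (GaugeConfig 3 L SU2)) (U : GaugeConfig 3 L SU2), |B.indicator (fun _ => (1 : ℝ)) U| ≤ 1 := fun B U => by
    by_cases hU : U ∈ B
    · rw [Set.indicator_of_mem hU, abs_one]
    · rw [Set.indicator_of_notMem hU, abs_zero]; exact zero_le_one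
  have hint : ∀ {B : Set (GaugeConfig 3 L SU2)}, MeasurableSet B →
      Integrable (fun Us => F Us * B.indicator (fun _ => (1 : ℝ)) (Us 0)) μ := fun {B} hB => by
    refine integrable_of_measurable_abs_le _ (hFm.mul ((measurable_const.indicator hB).comp (measurable_pi_apply 0))) (C := M ^ n * M) fun Us => ?_
    rw [abs_mul, abs_of_nonneg (hF0 Us)]
    calc F Us * |B.indicator (fun _ => (1 : ℝ)) (Us 0)| ≤ M ^ n * M * 1 := mul_le_mul (hFb Us) (hind1 B _) (abs_nonneg _) (by positivity)
      _ = M ^ n * M := mul_one _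
  have hIA := hint hAm
  have hIAc := hint hAm.compl
  -- split the ring
  have hsplit : ∀ Us, F Us = F Us * A.indicator (fun _ => (1 : ℝ)) (Us 0) + F Us * Aᶜ.indicator (fun _ => (1 : ℝ)) (Us 0) := by
    intro Us
    by_cases hU : Us 0 ∈ A
    · rw [Set.indicator_of_mem hU, Set.indicator_of_notMem (show Us 0 ∉ Aᶜ from fun h => h hU), mul_one, mul_zero, add_zero]
    · rw [Set.indicator_of_notMem hU, Set.indicator_of_mem (Set.mem_compl hU), mul_zero, mul_one, zero_add]
  have hZ : twistTrace L β (2 * L) = ∫ Us, F Us ∂μ := rfl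
  have hfarI : ∫ Us, F Us * Aᶜ.indicator (fun _ => (1 : ℝ)) (Us 0) ∂μ ≤ η * M ^ n := by
    have h := integral_mono hIAc (integrable_const (η * M ^ n)) hfar
    simpa only [integral_const, smul_eq_mul, probReal_univ, one_mul] using h
  rw [hZ]
  calc ∫ Us, F Us ∂μ = ∫ Us, (F Us * A.indicator (fun _ => (1 : ℝ)) (Us 0) + F Us * Aᶜ.indicator (fun _ => (1 : ℝ)) (Us 0)) ∂μ :=
        integral_congr_ae (ae_of_all _ fun Us => hsplit Us)
    _ = ∫ Us, F Us * A.indicator (fun _ => (1 : ℝ)) (Us 0) ∂μ + ∫ Us, F Us * Aᶜ.indicator (fun _ => (1 : ℝ)) (Us 0) ∂μ :=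
        integral_add hIA hIAc
    _ ≤ ∫ Us, F Us * A.indicator (fun _ => (1 : ℝ)) (Us 0) ∂μ + η * M ^ n := by linarith [hfarI]

end Summit.QuantumFields.YangMills.Theorems.FemtoTransferGap.TT

end
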